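import Literature.MathematicalPhysics.QuantumFieldTheory.Balaban1983to89.B2Prop31ZeroFieldConcrete
import Literature.MathematicalPhysics.QuantumFieldTheory.Balaban1983to89.B2Sect3BSmallFactors

/-!
# `Balaban1983to89.B2Ineq330ZeroFieldConcrete` — [Balaban1982Higgs2] (3.30)–(3.31) p. 590, *"We use Proposition 3.1 and we
obtain (3.30) … (3.31)"*, AT `Ã^ε = 0` ON THE CONCRETE (3.23)/(3.24)/(3.25) CARRIER: r14's kernel lemmas
`B2Sect3BSmallFactors.ineq330`/`ineq331` FED with the concrete objects — `Z(0)exp(−½⟨Φ,Δ(0)Φ⟩) = F325 R C a 0 m² Φ` (p252464),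
Proposition 3.1 in its zero-field form `B2Prop31ZeroFieldConcrete.prop31_zeroField_concrete` (p256491) and the printed k-th bond
sums `bondK` — so that the small factors `exp(−¼γ₀p(Lᵏε)²|Q|)` of (3.31) come out of the concrete Gaussian (3.25) with NO input left

statement-level skeleton of published theorems with citation tags; proofs where landed; nothing here is a claim about the Yang–Mills mass gap

CITATION HEADER.  T. Bałaban, *(Higgs)₂,₃ quantum fields in a finite volume. II. An upper bound*, Commun. Math. Phys. **86**
(1982) 555–594 [Balaban1982Higgs2], (3.30)–(3.31) p. 590 (PDF held `paper:balaban1982-cmp86-higgs23-ii`; p. 590 [PDF 36] READ AS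
IMAGE on the ×2 render `run/shared/lean/pub/pub-balaban/b2b-balaban-ref1/pages/1982-cmp86-higgs23-II/1982-cmp86-higgs23-II-p036-x2.png`).
Unit `lit-balaban-p15` gen 4, target 3, file 5 (Phase-2 proof seat p15; HOME `run/shared/lean/pub/lit-balaban/`).  SKELETON row
**B2.Eq3.32** (members (3.30), (3.31); owner r02; decls of record r14's `B2Sect3BSmallFactors.ineq330`, `ineq331`, `ineq331_printed`
— USED BY NAME here, not restated).

WHAT IS PRINTED (p. 590): *"We use Proposition 3.1 and we obtain Z(Ã^ε)exp(−½⟨Φ, Δ(Ã^ε)Φ⟩) ≤ Z(Ã^ε)exp(−¼⟨Φ, Δ(Ã^ε)Φ⟩)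
·exp(−¼(the right side of (3.26))). (3.30)  Now we estimate the characteristic functions by 1, except the functions ζ_{Λ₀⁽ᵏ⁾}.
These contain the functions χ^c_{Q_s⁽ᵏ⁾}, which give the restrictions of the form (Lᵏε)^{d−2}|U(Ã^ε(⟨x,x′⟩))φ_k(x′) − φ_k(x)|²
> p(Lᵏε)² for all the bonds ⟨x,x′⟩ ∈ Q_s⁽ᵏ⁾. The bonds of this set are contained in Λ₇⁽ᵏ⁻¹⁾′∩Λ₀⁽ᵏ⁾ᶜ ⊂ Λ₅⁽ᵏ⁻¹⁾′∩Λ₅⁽ᵏ⁾ᶜ, hence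
χ^c_{Q_s⁽ᵏ⁾} exp(−¼(kᵗʰ term of the right side of (3.26))) ≤ exp(−¼γ₀p(Lᵏε)²|Q_s⁽ᵏ⁾| + O((Lᵏε)^{κ₀})|Λ_k|). (3.31)"*

WHAT THIS MODULE PROVES (kernel-checked, 0 `sorry`, no definition, standard axioms; `Ã = 0`, so the `O((Lᵏε)^{κ₀})|Λ_k|` term
of (3.31) is absent): **`ineq330_zero_concrete`** — (3.30) for the concrete `F325`, `Z325`, `form325` at `Ã = 0` and every `Φ`, the
"right side of (3.26)" being `γ₀(bond₀ + Σ_k bondK) + γ₀(mass₀ + Σ_k massK)`; **`bondK_ge_of_large`** (if every bond of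
`Q ⊂ {bonds ⊂ Λ_k}` carries `(Lᵏε)^{d−2}|ψ(x′) − ψ(x)|² > P` then `P·|Q| ≤ bondK`); **`ineq331_zero_concrete`** — (3.31) at `Ã = 0`:
`exp(−¼·γ₀(bondK + massK)) ≤ exp(−¼γ₀P|Q|)` (with the indicator `χ ∈ {0,1}`: `ineq331_zero_concrete_chi`).
HONEST SCOPE.  The sets `Q_s⁽ᵏ⁾` and the characteristic functions (3.21) are not constructed: `Q` is any set of bonds inside `Λ_k`
and the restriction is the hypothesis `hlarge`; `P` is any real (the print: `P = p(Lᵏε)²`); zero vector field only.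
-/

noncomputable section

open MeasureTheory Finset Real
open scoped BigOperators ENNReal InnerProductSpace

namespace Literature.MathematicalPhysics.QuantumFieldTheory.Balaban1983to89.B2Ineq330ZeroFieldConcrete

open Literature.MathematicalPhysics.QuantumFieldTheory.Balaban1983to89.HiggsLattice
open Literature.MathematicalPhysics.QuantumFieldTheory.Balaban1983to89.HiggsAveraging
open Literature.MathematicalPhysics.QuantumFieldTheory.Balaban1983to89.HiggsCovariance
open Literature.MathematicalPhysics.QuantumFieldTheory.Balaban1983to89.HiggsCovariancePos
open Literature.MathematicalPhysics.QuantumFieldTheory.Balaban1983to89.B2Eq337ScalarIntegration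
open Literature.MathematicalPhysics.QuantumFieldTheory.Balaban1983to89.B2Eq325ConcreteSchur
open Literature.MathematicalPhysics.QuantumFieldTheory.Balaban1983to89.B2Ineq327ConcreteNeumann
open Literature.MathematicalPhysics.QuantumFieldTheory.Balaban1983to89.B2Eq328ConcretePieces
open Literature.MathematicalPhysics.QuantumFieldTheory.Balaban1983to89.B2Eq328DeltaK
open Literature.MathematicalPhysics.QuantumFieldTheory.Balaban1983to89.B2Prop31ZeroFieldConcrete
open Literature.MathematicalPhysics.QuantumFieldTheory.Balaban1983to89.B2Sect3BSmallFactors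

variable {P : HiggsLattice.Params} {N K : ℕ}

section Ineq330

variable (R : Regions P K) (C : ChargeData N) {a msq : ℝ}

/-- **(3.30) AT `Ã^ε = 0` ON THE CONCRETE CARRIER**: for every nested region data and every configuration `Φ` of (3.24),
`Z(0)exp(−½⟨Φ,Δ(0)Φ⟩) ≤ Z(0)exp(−¼⟨Φ,Δ(0)Φ⟩)·exp(−¼·(γ₀(bond₀ + Σ_k bondK) + γ₀(mass₀ + Σ_k massK)))` — r14's kernel `ineq330`
fed with `F325 = Z325·exp(−½ form325)` (`eq325_concrete`), `Z325 > 0` and Proposition 3.1 in the zero-field form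
`prop31_zeroField_concrete`. [cite: Balaban1982Higgs2, (3.30) p.590] -/
theorem ineq330_zero_concrete (hR : Nested R) (hK : K ≤ P.K) (hε : P.mesh K ≤ 1) (ha : 0 < a) (hL : 1 < P.L)
    (hmsq : 0 < msq) (Φ : Cfg R N) :
    F325 R C a (0 : HiggsLattice.VecField P 0) msq Φ
      ≤ Z325 R C a (0 : HiggsLattice.VecField P 0) msq
          * Real.exp (-(form325 R C a (0 : HiggsLattice.VecField P 0) msq Φ / 4))
          * Real.exp (-((gamma0 P a msq * (bond0 R C (0 : HiggsLattice.VecField P 0) Φ.1 + ∑ j, bondK R j (resL R j Φ))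
              + gamma0 P a msq * (mass0 R msq Φ.1 + ∑ j, massK R msq j (resL R j Φ))) / 4)) := by
  rw [eq325_concrete R C (0 : HiggsLattice.VecField P 0) ha hL hmsq Φ]
  have e : Real.exp (-(1/2 : ℝ) * form325 R C a (0 : HiggsLattice.VecField P 0) msq Φ)
      = Real.exp (-(form325 R C a (0 : HiggsLattice.VecField P 0) msq Φ / 2)) := by
    congr 1
    ring
  rw [e]
  exact ineq330 (Z325_pos R C (0 : HiggsLattice.VecField P 0) ha hL hmsq).le
    (prop31_zeroField_concrete R C hR hK hε ha hL hmsq Φ)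

end Ineq330

section Ineq331

variable (R : Regions P K) {a msq : ℝ}

/-- **The large-gradient restriction feeds the bond sum**: if every bond of a set `Q` of bonds inside `Λ_k` carries
`(Lᵏε)^{d−2}|ψ(x′) − ψ(x)|² > P` (the restriction given by `χ^c_{Q_s⁽ᵏ⁾}`, p. 590), then `P·|Q| ≤ bondK R j ψ`.
[cite: Balaban1982Higgs2, (3.31) p.590] -/
theorem bondK_ge_of_large (j : Fin K) (ψ : LSite R j → V N) (Q : Finset (HiggsLattice.PBond P (j.val + 1)))
    (hQ : ∀ c ∈ Q, Inside (R.block j) c) (Pv : ℝ)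
    (hlarge : ∀ c ∈ Q, Pv < P.mesh (j.val + 1) ^ P.d * (P.mesh (j.val + 1))⁻¹ ^ 2
      * ‖extL R j ψ c.tgt - extL R j ψ c.src‖ ^ 2) :
    Pv * Q.card ≤ bondK R j ψ := by
  classical
  rw [bondK_eq_sum_printed, ← Finset.sum_filter]
  have hsub : Q ⊆ Finset.univ.filter (fun c : HiggsLattice.PBond P (j.val + 1) => Inside (R.block j) c) := fun c hc =>
    Finset.mem_filter.2 ⟨Finset.mem_univ _, hQ c hc⟩
  calc Pv * Q.card = ∑ _c ∈ Q, Pv := by rw [Finset.sum_const, nsmul_eq_mul, mul_comm]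
    _ ≤ ∑ c ∈ Q, P.mesh (j.val + 1) ^ P.d * (P.mesh (j.val + 1))⁻¹ ^ 2 * ‖extL R j ψ c.tgt - extL R j ψ c.src‖ ^ 2 :=
        Finset.sum_le_sum fun c hc => (hlarge c hc).le
    _ ≤ _ := Finset.sum_le_sum_of_subset_of_nonneg hsub fun c _ _ =>
        mul_nonneg (mul_nonneg (pow_nonneg (P.mesh_pos _).le _) (sq_nonneg _)) (sq_nonneg _)

/-- **(3.31) AT `Ã^ε = 0` ON THE CONCRETE CARRIER** (no `O((Lᵏε)^{κ₀})` term at zero field): under the large-gradient restriction on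
the bonds of `Q ⊂ {bonds ⊂ Λ_k}`, `exp(−¼·γ₀(bondK + massK)) ≤ exp(−¼γ₀P|Q|)` (`γ₀ ≥ 0`, `m² ≥ 0`).
[cite: Balaban1982Higgs2, (3.31) p.590] -/
theorem ineq331_zero_concrete (hmsq : 0 ≤ msq) {γ₀ : ℝ} (hγ : 0 ≤ γ₀) (j : Fin K) (ψ : LSite R j → V N)
    (Q : Finset (HiggsLattice.PBond P (j.val + 1))) (hQ : ∀ c ∈ Q, Inside (R.block j) c) (Pv : ℝ)
    (hlarge : ∀ c ∈ Q, Pv < P.mesh (j.val + 1) ^ P.d * (P.mesh (j.val + 1))⁻¹ ^ 2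
      * ‖extL R j ψ c.tgt - extL R j ψ c.src‖ ^ 2) :
    Real.exp (-(γ₀ * (bondK R j ψ + massK R msq j ψ) / 4)) ≤ Real.exp (-(γ₀ * Pv * Q.card / 4)) := by
  refine Real.exp_le_exp.2 ?_
  have h1 := bondK_ge_of_large R j ψ Q hQ Pv hlarge
  have h2 := massK_nonneg R hmsq j ψ
  have h3 : γ₀ * (Pv * Q.card) ≤ γ₀ * (bondK R j ψ + massK R msq j ψ) := mul_le_mul_of_nonneg_left (by linarith) hγ
  linarith

/-- (3.31) at `Ã^ε = 0` with the indicator `χ = χ^c_Q ∈ {0, 1}` displayed, in the shape of r14's `ineq331_printed` (`E = 0`).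
[cite: Balaban1982Higgs2, (3.31) p.590] -/
theorem ineq331_zero_concrete_chi (hmsq : 0 ≤ msq) {γ₀ : ℝ} (hγ : 0 ≤ γ₀) (j : Fin K) (ψ : LSite R j → V N)
    (Q : Finset (HiggsLattice.PBond P (j.val + 1))) (hQ : ∀ c ∈ Q, Inside (R.block j) c) (Pv : ℝ) {χ : ℝ}
    (hχ : χ = 0 ∨ χ = 1)
    (hlarge : χ = 1 → ∀ c ∈ Q, Pv < P.mesh (j.val + 1) ^ P.d * (P.mesh (j.val + 1))⁻¹ ^ 2
      * ‖extL R j ψ c.tgt - extL R j ψ c.src‖ ^ 2) :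
    χ * Real.exp (-(γ₀ * (bondK R j ψ + massK R msq j ψ) / 4)) ≤ Real.exp (-(γ₀ * Pv * Q.card / 4)) := by
  rcases hχ with h0 | h1
  · rw [h0, zero_mul]
    exact (Real.exp_pos _).le
  · rw [h1, one_mul]
    exact ineq331_zero_concrete R hmsq hγ j ψ Q hQ Pv (hlarge h1)

end Ineq331

end Literature.MathematicalPhysics.QuantumFieldTheory.Balaban1983to89.B2Ineq330ZeroFieldConcrete
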